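import Summits.BirchSwinnertonDyer.Rank1Residual.Additive.QuadraticBranchEvenLocalControl
import Summits.BirchSwinnertonDyer.Rank1Residual.Additive.KummerCountIdleDual
import Summits.BirchSwinnertonDyer.Rank1Residual.Additive.SignedSelmerLevelBridge
import Summits.BirchSwinnertonDyer.Rank1Residual.Additive.KummerLevelStabilisation
import Summits.BirchSwinnertonDyer.Rank1Residual.Additive.QuadraticTwistTowerNoPTorsion
import Summits.BirchSwinnertonDyer.Rank1Residual.Additive.GoodSupersingularPadicModel
import Summits.BirchSwinnertonDyer.Rank1Residual.Additive.StrictSignedSelmerInftyLocal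
import HarnessLib

/-!
# The EVEN defect count at finite level: `[A₀⁺ : Sel⁺(W/ℚ_0)] = ∏_{ℓ ∈ T} [𝓣_ℓ : 𝓚_ℓ]` for the
# `p*`-twist in analytic rank ZERO (cell `bsd-potss`, seat `bsd-potss-ctrl` g2; R-ctrl-17 = K8 crux
# `ExactControlEven` on the `p ∣ Tam` rows, brick 2 — the plus / rank-0 twin of x1b's file 107
# `relIndex_strictSignedSelmerLayer_localPreimage_eq_of_quadraticTwist_signedPrime`)

HONEST FRAMING (cell `bsd-potss`, run/shared/lean/pub/bsd-potss/; FULL-BSD rank ≤ 1 programme,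
tranche 1b): TOOL THEOREMS ONLY — no definition, no named Literature fact introduced (the ONE fact-shaped
input is `poitouTate_selmerStructure_duality_real ℚ`, hypothesis `hPT`, as in x1b's files 63/107/120),
no `sorry`, axioms standard. (L0⁺) is CONSUMED AS A THEOREM (`evenBranchPlusLocalControlZeroAt_holds`).
Nothing is booked; no label / mark / count moves; nothing about (C1_η) or `BSD(W, p)` is claimed.

## What (x1b's level-`m` vocabulary: `Ψ_m` = `levelToLayerZero`, `𝓚` = the Kummer structure on
## `W[p^m]`, `𝓣` = the tower structure (`𝓣_v = θ_v⁻¹(𝒦_{v,0})`, Kummer at `∞`), `A₀⁺ = Sel^{loc,∞}` on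
## `A = ⨆_n E^{+,str}(ℚ_n·ℚ_p)`, `S₀⁺ = Sel^{+,str}(W/ℚ_0) = Sel⁺(W/ℚ_0)`)
* §1 AT `v₀ = (p)`: `localization_mem_kummer_iff_levelToLayerZero_mem_localKummer_zero` —
  **`loc_{v₀} c ∈ 𝓚_{m,v₀} ↔ Ψ_m c` satisfies the level-`0` plus Kummer condition at `ℚ_[p]`**
  (= Kummer of ALL of `E(ℚ_p)` = the classical kernel, `localKummerOverOfEmb_fixedPoints_eq`; model
  transport `ℚ_{v₀} ↔ ℚ_[p]`, this seat's file 4); `mem_plusSig_of_mem_localKummer_zero` — a layer-`0`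
  class Kummer at `ℚ_[p]` satisfies the level-`∞` PLUS condition at every conjugate (`E(ℚ_p) ⊆ E⁺(n)`).
* §2 **`relIndex_strictSignedSelmerLayer_one_localPreimage_eq_prod`** — with `𝓖 = 𝓣[v₀ ↦ 𝓣_{v₀} ⊓ 𝓚_{v₀}]`:
  `c ∈ H¹_𝓖 ↔ Ψ_m c ∈ A₀⁺` ((L0⁺) THEOREM + §1), `c ∈ H¹_𝓚 ↔ Ψ_m c ∈ S₀⁺`, every `H¹_𝓚`-class is
  locally trivial at `T` once `p^e S₀⁺ = 0` and `p^{m−e}` kills `𝓚_{m,ℓ}` (x1b file 64), so brick 1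
  (`RankZeroCount.relIndex_kummer_eq_prod_of_localization_eq_zero`) and x1b's index transfer (file 72)
  give **`[A₀⁺ : S₀⁺] = ∏_{ℓ ∈ T} [𝓣_ℓ : 𝓚_ℓ]`** — NO receptacle at `v₀`, NO Mordell–Weil line.

References: [GreenbergLNM1716] §3 (pp. 85–90), §4 (pp. 98–103); [Kobayashi2003] Def. 2.1 (p. 5), Thm. 9.3
with (9.33) (pp. 26–27); [MilneADT2006] I Thm. 4.10, Cor. 3.4; [Howard2004HeegnerKolyvagin] Thm. 2.1.11.
-/

noncomputable section

open scoped Classical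

open CategoryTheory Field Function NumberField IsDedekindDomain WeierstrassCurve
open Literature.NumberTheory.EllipticCurves
open Literature.NumberTheory.GaloisRepresentations
open Literature.NumberTheory.GaloisRepresentations.DiscreteGaloisModule (SelmerStructure)
open Literature.NumberTheory.GaloisCohomology
open Literature.NumberTheory.EllipticCurves.Kobayashi2003
open Summit.BirchSwinnertonDyer.Rank1Residual.X11b.Levels
open Summit.BirchSwinnertonDyer.Rank1Residual.X11b
open Summit.BirchSwinnertonDyer.Rank1Residual.Additive.LevelBridge
open scoped ContRepresentation

namespace Summit.BirchSwinnertonDyer.Rank1Residual.Additive.RankZeroCount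

/-! ## §1 The plus condition at `v₀ = (p)` read at level `m` -/

section LocalAtP

variable (W : WeierstrassCurve ℚ) [W.IsElliptic] (p : ℕ) [hp : Fact p.Prime] (κ : ZpExtension ℚ p) (m : ℕ)

omit [W.IsElliptic] in
/-- The bottom plus local group is all of `E(ℚ_p)` (`E^{+,str}(ℚ_0·ℚ_p) = E(ℚ_p)`: Def. 2.1 has no
clause on the even side and Def. 1.1 is empty at `n = 0`). [cite: Kobayashi2003, Def. 1.1 (p. 2), Def. 2.1 (p. 5)] -/
theorem strictSignedLocalPoints_one_zero_eq_fixedPoints :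
    strictSignedLocalPoints κ ℚ_[p] W 1 0 =
      FixedPoints.addSubgroup (localSubgroupOfEmb (κ.layerSubgroup 0) (closureEmb (K := ℚ) ℚ_[p]))
        (localPoints W ℚ_[p]) := by
  rw [strictSignedLocalPoints, strictSignedLocalPointsOfEmb_one, signedLocalPointsOfEmb_zero]
  rfl

omit [W.IsElliptic] in
/-- **`loc_{v₀} c ∈ 𝓚_{m,v₀} ↔ Ψ_m c` is level-`0` plus-Kummer at `ℚ_[p]`** (`v₀ = (p)`): the local
Kummer condition at level `m` is `θ_{v₀}(loc c) = 0`, i.e. `Ψ_m c` dies in `H¹(ℚ_{v₀}, W)` (x1b file 71);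
the classical kernel does not depend on the model `ℚ_{v₀} ↔ ℚ_[p]` (this seat's file 4); and at `ℚ_[p]`
it is the Kummer condition cut out by all of `E(ℚ_p)` (`localKummerOverOfEmb_fixedPoints_eq`), the
bottom plus group. [cite: GreenbergLNM1716, §2 and §3 p. 85] [cite: Kobayashi2003, Def. 1.1 (p. 2)] -/
theorem localization_mem_kummer_iff_levelToLayerZero_mem_localKummer_zero
    (v₀ : HeightOneSpectrum (𝓞 ℚ)) (hv₀ : (Rat.HeightOneSpectrum.primesEquiv (R := 𝓞 ℚ)).symm ⟨p, hp.out⟩ = v₀)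
    (c : galoisCohomology (W.torsionGaloisModule ((p ^ m : ℕ) : ℤ)) 1) :
    galoisCohomology.localization (W.torsionGaloisModule ((p ^ m : ℕ) : ℤ)) (Sum.inr v₀) 1 c ∈
        W.kummerSelmerStructure ((p ^ m : ℕ) : ℤ) (Sum.inr v₀) ↔
      resH1Hom (Literature.NumberTheory.EllipticCurves.subgroupIncl (κ.layerSubgroup 0)) (AddMonoidHom.id (geomPrimaryTorsion W p))
          (fun _ _ ↦ rfl) (galoisCohomology.map (primaryInclusion W p m) 1 c) ∈
        localKummerOverOfEmb W p (κ.layerSubgroup 0) (closureEmb (K := ℚ) ℚ_[p])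
          (strictSignedLocalPoints κ ℚ_[p] W 1 0) := by
  subst hv₀
  haveI : CompactSpace (absoluteGaloisGroup ℚ) := compactSpace_absoluteGaloisGroup ℚ
  haveI : CompactSpace (κ.layerSubgroup 0) :=
    isCompact_iff_compactSpace.mp (Subgroup.isClosed_of_isOpen _ (κ.isOpen_layerSubgroup 0)).isCompact
  rw [strictSignedLocalPoints_one_zero_eq_fixedPoints, localKummerOverOfEmb_fixedPoints_eq,
    ← localKerOver_eq_ofEmb,
    StrictSignedControlZero.mem_localKerOver_padic_iff_adicCompletion W p (κ.layerSubgroup 0)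
      κ.layerSubgroup_zero, mem_localKerOver_iff, localResOver_levelToLayerZero]
  exact ⟨fun h ↦ resH1Hom_map_eq_zero_of_mem_kummerLocalConditionAt W p κ m _ h,
    fun h ↦ mem_kummerLocalConditionAt_of_resH1Hom_map_eq_zero W p κ m _ h⟩

omit [W.IsElliptic] in
/-- **A layer-`0` class that is Kummer at `ℚ_[p]` (for all of `E(ℚ_p)`) satisfies the level-`∞` PLUS
condition at every conjugate**: `E(ℚ_p) = E^{+,str}(ℚ_0·ℚ_p) ⊆ ⨆_n E^{+,str}(ℚ_n·ℚ_p)`, Kummer witnesses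
restrict (`resOfLe_mem_localKummerOverOfEmb`), and conjugations act trivially on `H¹(κ⁻¹(p⁰ℤ_p), ·)`.
[cite: Kobayashi2003, Def. 1.1 (p. 2), Def. 2.1 (p. 5)] [cite: GreenbergLNM1716, §2 p. 71] -/
theorem mem_plusSig_of_mem_localKummer_zero (y : W.subgroupH1 p (κ.layerSubgroup 0))
    (hy : y ∈ localKummerOverOfEmb W p (κ.layerSubgroup 0) (closureEmb (K := ℚ) ℚ_[p])
      (strictSignedLocalPoints κ ℚ_[p] W 1 0)) :
    y ∈ (⨅ σ : absoluteGaloisGroup ℚ,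
        (localKummerOverOfEmb W p κ.kerSubgroup (closureEmb (K := ℚ) ℚ_[p])
            (⨆ n, strictSignedLocalPoints κ ℚ_[p] W 1 n)).comap (W.conjH1 p κ.kerSubgroup σ)).comap
        (W.layerToInfty κ 0) := by
  rw [AddSubgroup.mem_comap, AddSubgroup.mem_iInf]
  intro σ
  rw [AddSubgroup.mem_comap]
  have e : W.conjH1 p κ.kerSubgroup σ (W.layerToInfty κ 0 y) =
      W.layerToInfty κ 0 (W.conjH1 p (κ.layerSubgroup 0) σ y) := by
    change _ = ((W.resOfLe p (κ.kerSubgroup_le_layerSubgroup 0)).comp (W.conjH1 p (κ.layerSubgroup 0) σ)) y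
    rw [resOfLe_comp_conjH1_holds]
    rfl
  rw [e, W.conjH1_of_mem_holds p (κ.layerSubgroup 0) (mem_layerSubgroup_zero p κ σ), AddMonoidHom.id_apply]
  exact resOfLe_mem_localKummerOverOfEmb W p (closureEmb (K := ℚ) ℚ_[p]) (κ.kerSubgroup_le_layerSubgroup 0) _
    (localKummerOverOfEmb_mono (le_iSup (fun n ↦ strictSignedLocalPoints κ ℚ_[p] W 1 n) 0) hy)

end LocalAtP

/-! ## §2 The count -/

section Count

variable (W : WeierstrassCurve ℚ) [W.IsElliptic] [W.IsGloballyMinimal] (p : ℕ) [hp : Fact p.Prime]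
  (κ : ZpExtension ℚ p) (m : ℕ)

/-- **THE EVEN DEFECT COUNT: `[A₀⁺ : Sel⁺(W/ℚ_0)] = ∏_{ℓ ∈ T} [𝓣_ℓ : 𝓚_ℓ]`** for the `p*`-twist `W` of a
globally minimal good `a_p = 0` curve `V` (`p` odd) in the RANK-ZERO shape. Binders: `hPT`; the tower
structure `𝓣` on `W[p^m]` (`h𝓣fin`, `h𝓣inf`) and the exceptional set `T ∌ v₀` with `𝒦_{v,0}[p^∞] = 0`
off `T ∪ {v₀}` (`hT0`); `#A₀⁺ ∣ p^a`; `p^e` kills `Sel⁺(W/ℚ_0)` (rank zero: `Sel_{p^∞}(W/ℚ)` finite);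
`p^{m−e}` kills `𝓚_{m,ℓ}` at `ℓ ∈ T`; `a ≤ m`, `e ≤ m`, `1 ≤ m`; `κ` cyclotomic. Proof in the module
docstring. CONDITIONAL on exactly these; nothing booked.
[cite: GreenbergLNM1716, §3 pp. 85–90, §4 pp. 98–103] [cite: Kobayashi2003, Thm. 9.3 with (9.33) (pp. 26–27)]
[cite: MilneADT2006, I Thm. 4.10] [cite: Howard2004HeegnerKolyvagin, Thm. 2.1.11 (arXiv:1202.6340 p. 6)] -/
theorem relIndex_strictSignedSelmerLayer_one_localPreimage_eq_prod
    (hm : 1 ≤ m) (hp2 : p ≠ 2) (hκ : κ.IsCyclotomic) (Cv : VariableChange ℚ) (V : WeierstrassCurve ℚ)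
    [V.IsElliptic] [V.IsGloballyMinimal] (hCV : Cv • W.quadraticTwist ((-1) ^ (p / 2) * p) = V)
    (hgood : V.HasGoodReductionAtPrime p) (hap : V.frobeniusTrace p = 0)
    (hPT : poitouTate_selmerStructure_duality_real ℚ)
    (v₀ : HeightOneSpectrum (𝓞 ℚ)) (hv₀ : (Rat.HeightOneSpectrum.primesEquiv (R := 𝓞 ℚ)).symm ⟨p, hp.out⟩ = v₀)
    (T : Finset (HeightOneSpectrum (𝓞 ℚ))) (hv₀T : v₀ ∉ T)
    (𝓣 : SelmerStructure (W.torsionGaloisModule ((p ^ m : ℕ) : ℤ)))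
    (h𝓣fin : ∀ v : HeightOneSpectrum (𝓞 ℚ), 𝓣 (Sum.inr v) =
      (W.localTowerKer κ (v.adicCompletion ℚ) 0).comap
        ((resH1Hom (Literature.NumberTheory.EllipticCurves.subgroupIncl
            (localSubgroup (κ.layerSubgroup 0) (v.adicCompletion ℚ)))
          (AddMonoidHom.id (localPoints W (v.adicCompletion ℚ))) (fun _ _ ↦ rfl)).comp
          (galoisCohomology.map
            (W.torsionPointsMapIntertwining ((p ^ m : ℕ) : ℤ) (v.adicCompletion ℚ)) 1)))
    (h𝓣inf : ∀ w : InfinitePlace ℚ, 𝓣 (Sum.inl w) = W.kummerSelmerStructure ((p ^ m : ℕ) : ℤ) (Sum.inl w))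
    (hT0 : ∀ v : HeightOneSpectrum (𝓞 ℚ), v ∉ T →
      v ≠ v₀ → W.localTowerKerPrimary κ (v.adicCompletion ℚ) 0 = ⊥)
    {a e : ℕ}
    (hA₀card : Nat.card ↥((W.selmerInfty κ ⊓ ⨅ σ : absoluteGaloisGroup ℚ,
        (localKummerOverOfEmb W p κ.kerSubgroup (closureEmb (K := ℚ) ℚ_[p])
          (⨆ n, strictSignedLocalPoints κ ℚ_[p] W 1 n)).comap
            (W.conjH1 p κ.kerSubgroup σ)).comap (W.layerToInfty κ 0)) ∣ p ^ a)
    (ham : a ≤ m)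
    (hSel : ∀ y ∈ strictSignedSelmerLayer W κ ℚ_[p] 1 0, p ^ e • y = 0) (hem : e ≤ m)
    (hkill : ∀ w ∈ T, ∀ x ∈ W.kummerSelmerStructure ((p ^ m : ℕ) : ℤ) (Sum.inr w),
      p ^ (m - e) • x = 0) :
    (strictSignedSelmerLayer W κ ℚ_[p] 1 0).relIndex
        ((W.selmerInfty κ ⊓ ⨅ σ : absoluteGaloisGroup ℚ,
          (localKummerOverOfEmb W p κ.kerSubgroup (closureEmb (K := ℚ) ℚ_[p])
            (⨆ n, strictSignedLocalPoints κ ℚ_[p] W 1 n)).comap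
              (W.conjH1 p κ.kerSubgroup σ)).comap (W.layerToInfty κ 0)) =
      ∏ w ∈ T, (W.kummerSelmerStructure ((p ^ m : ℕ) : ℤ) (Sum.inr w)).relIndex (𝓣 (Sum.inr w)) := by
  -- abbreviations
  set 𝓚 : SelmerStructure (W.torsionGaloisModule ((p ^ m : ℕ) : ℤ)) :=
    W.kummerSelmerStructure ((p ^ m : ℕ) : ℤ) with h𝓚def
  set Sig : AddSubgroup (W.subgroupH1 p (κ.layerSubgroup 0)) := (⨅ σ : absoluteGaloisGroup ℚ,
    (localKummerOverOfEmb W p κ.kerSubgroup (closureEmb (K := ℚ) ℚ_[p])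
      (⨆ n, strictSignedLocalPoints κ ℚ_[p] W 1 n)).comap (W.conjH1 p κ.kerSubgroup σ)).comap
    (W.layerToInfty κ 0) with hSig
  set A₀ : AddSubgroup (W.subgroupH1 p (κ.layerSubgroup 0)) := (W.selmerInfty κ ⊓
      ⨅ σ : absoluteGaloisGroup ℚ,
        (localKummerOverOfEmb W p κ.kerSubgroup (closureEmb (K := ℚ) ℚ_[p])
          (⨆ n, strictSignedLocalPoints κ ℚ_[p] W 1 n)).comap
            (W.conjH1 p κ.kerSubgroup σ)).comap (W.layerToInfty κ 0) with hA₀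
  have hA₀eq : A₀ = W.selmerInftyPreimage κ 0 ⊓ Sig := by
    rw [hA₀, AddSubgroup.comap_inf]
    rfl
  set S₀ := strictSignedSelmerLayer W κ ℚ_[p] 1 0 with hS₀
  set K0 := localKummerOverOfEmb W p (κ.layerSubgroup 0) (closureEmb (K := ℚ) ℚ_[p])
    (strictSignedLocalPoints κ ℚ_[p] W 1 0) with hK0
  -- (Γ) `W[p^∞]^{Γ_ℚ} = 0` from `W[p^∞]^{Gal(ℚ̄/ℚ_∞)} = 0` (x1b file 55), and divisibility
  obtain ⟨M₀, hΔ, hA, hVM₀⟩ := exists_goodSupersingularPadicModel hp2 V hgood hap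
  have hc := sq_ne_neg_one_pow_mul_prime hp.out (p / 2)
  have hΓ : ∀ Q : W.geomPrimaryTorsion p,
      (∀ σ : absoluteGaloisGroup ℚ, X11b.LocBridge.primaryGaloisModule W p σ Q = Q) → Q = 0 := by
    intro Q hQ
    have hmem : Q ∈ FixedPoints.addSubgroup κ.kerSubgroup (W.geomPrimaryTorsion p) := by
      rw [FixedPoints.mem_addSubgroup]
      intro σ
      exact hQ σ
    rw [fixedPoints_kerSubgroup_geomPrimaryTorsion_eq_bot_of_quadraticTwist κ hp2 W hc Cv hCV M₀ hΔ hA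
      hVM₀] at hmem
    exact (AddSubgroup.mem_bot).mp hmem
  have hdiv : W.zsmul_geomPoints_surjective := W.zsmul_geomPoints_surjective_holds
  -- the structure `𝓖 = 𝓣[v₀ ↦ 𝓣_{v₀} ⊓ 𝓚_{v₀}]`
  set 𝓖 : SelmerStructure (W.torsionGaloisModule ((p ^ m : ℕ) : ℤ)) :=
    Function.update 𝓣 (Sum.inr v₀) (𝓣 (Sum.inr v₀) ⊓ 𝓚 (Sum.inr v₀)) with h𝓖
  -- §1 at `v₀`
  have hL1 := localization_mem_kummer_iff_levelToLayerZero_mem_localKummer_zero W p κ m v₀ hv₀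
  -- (α) `c ∈ H¹_𝓖 ↔ Ψ_m c ∈ A₀⁺`
  have hiffA : ∀ c, c ∈ 𝓖.selmerGroup ↔
      resH1Hom (Literature.NumberTheory.EllipticCurves.subgroupIncl (κ.layerSubgroup 0)) (AddMonoidHom.id (geomPrimaryTorsion W p))
        (fun _ _ ↦ rfl) (galoisCohomology.map (primaryInclusion W p m) 1 c) ∈ A₀ := by
    intro c
    rw [hA₀eq, h𝓖]
    refine mem_selmerGroup_update_inf_iff_levelToLayerZero_mem_inf W p κ m 𝓣 (W.selmerInftyPreimage κ 0)
      (mem_selmerGroup_iff_levelToLayerZero_mem_selmerInftyPreimage W p κ m 𝓣 h𝓣fin h𝓣inf)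
      (Sum.inr v₀) (𝓚 (Sum.inr v₀)) Sig (fun c hc ↦ ⟨fun h ↦ ?_, fun h ↦ ?_⟩) c
    · exact mem_plusSig_of_mem_localKummer_zero W p κ _ ((hL1 c).mp h)
    · refine (hL1 c).mpr (evenBranchPlusLocalControlZeroAt_holds W p V Cv hp2 hCV hgood hap κ hκ _ ?_)
      rw [AddSubgroup.comap_inf]
      exact ⟨hc, h⟩
  -- (β) `c ∈ H¹_𝓚 ↔ Ψ_m c ∈ S₀⁺`
  have hconj : ∀ (σ : absoluteGaloisGroup ℚ) (y : W.subgroupH1 p (κ.layerSubgroup 0)),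
      W.conjH1 p (κ.layerSubgroup 0) σ y = y := fun σ y ↦ by
    rw [W.conjH1_of_mem_holds p (κ.layerSubgroup 0) (mem_layerSubgroup_zero p κ σ), AddMonoidHom.id_apply]
  have hiffS : ∀ c, c ∈ 𝓚.selmerGroup ↔
      resH1Hom (Literature.NumberTheory.EllipticCurves.subgroupIncl (κ.layerSubgroup 0)) (AddMonoidHom.id (geomPrimaryTorsion W p))
        (fun _ _ ↦ rfl) (galoisCohomology.map (primaryInclusion W p m) 1 c) ∈ S₀ := by
    intro c
    rw [hS₀, Additive.mem_strictSignedSelmerLayer_iff, levelToLayerZero_mem_selmerLayer_zero_iff]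
    simp only [hconj]
    constructor
    · intro h
      refine ⟨h, fun _ ↦ (hL1 c).mp ?_⟩
      exact (SelmerStructure.mem_selmerGroup_iff _ _).mp h (Sum.inr v₀)
    · exact fun h ↦ h.1
  -- the level `p^m` kills `A₀⁺`
  have hA₀m : ∀ z ∈ A₀, p ^ m • z = 0 := fun z hz ↦
    KummerLevelStabilisation.nsmul_eq_zero_of_natCard_dvd A₀ (hA₀card.trans (pow_dvd_pow p ham)) hz
  -- (γ) every `H¹_𝓚`-class is locally trivial at `T`
  have hloc0 : ∀ c ∈ 𝓚.selmerGroup, ∀ w ∈ T,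
      galoisCohomology.localization (W.torsionGaloisModule ((p ^ m : ℕ) : ℤ)) (Sum.inr w) 1 c = 0 := by
    intro c hc w hw
    haveI : CharZero (Place.Completion (Sum.inr w : Place ℚ)) := charZero_adicCompletion w
    have hpe : p ^ e • c = 0 := by
      set F : galoisCohomology (W.torsionGaloisModule ((p ^ m : ℕ) : ℤ)) 1 →+
          W.subgroupH1 p (κ.layerSubgroup 0) :=
        (resH1Hom (Literature.NumberTheory.EllipticCurves.subgroupIncl (κ.layerSubgroup 0))
          (AddMonoidHom.id (geomPrimaryTorsion W p)) (fun _ _ ↦ rfl)).comp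
          (galoisCohomology.map (primaryInclusion W p m) 1) with hF
      have h1 : F (p ^ e • c) = F 0 := by
        rw [map_nsmul, map_zero]
        exact hSel _ ((hiffS c).mp hc)
      exact levelToLayerZero_injective W p κ m hΓ h1
    exact KummerLevelStabilisation.localization_eq_zero_of_nsmul_eq_zero W p hdiv hΓ hem (Sum.inr w)
      (hkill w hw) hpe ((SelmerStructure.mem_selmerGroup_iff _ _).mp hc (Sum.inr w))
  -- `𝓖 ⊇ 𝓚` at `T`, `𝓖 = 𝓚` off `T`
  have hv₀ne : ∀ w ∈ T, (Sum.inr w : Place ℚ) ≠ Sum.inr v₀ := fun w hw h ↦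
    hv₀T ((Sum.inr_injective h) ▸ hw)
  have h𝓖T : ∀ w ∈ T, 𝓚 (Sum.inr w) ≤ 𝓖 (Sum.inr w) := fun w hw ↦ by
    rw [h𝓖, Function.update_of_ne (hv₀ne w hw), h𝓣fin w]
    exact kummerSelmerStructure_inr_le_comap_localTowerKer W p κ m w
  have h𝓖eqT : ∀ w ∈ T, 𝓖 (Sum.inr w) = 𝓣 (Sum.inr w) := fun w hw ↦ by
    rw [h𝓖, Function.update_of_ne (hv₀ne w hw)]
  have h𝓖off : ∀ v : Place ℚ, (∀ w ∈ T, v ≠ Sum.inr w) → 𝓖 v = 𝓚 v := by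
    intro v hv
    by_cases hv0 : v = Sum.inr v₀
    · subst hv0
      rw [h𝓖, Function.update_self, inf_eq_right, h𝓣fin v₀]
      exact kummerSelmerStructure_inr_le_comap_localTowerKer W p κ m v₀
    · rw [h𝓖, Function.update_of_ne hv0]
      refine eq_kummerSelmerStructure_of_not_mem W p κ m 𝓣 h𝓣fin h𝓣inf (↑T ∪ {v₀}) (fun v' hv' ↦ ?_) v
        (fun w hw ↦ ?_)
      · simp only [Set.mem_union, Finset.mem_coe, Set.mem_singleton_iff, not_or] at hv'
        exact hT0 v' hv'.1 hv'.2
      · rcases hw with hw | hw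
        · exact hv w hw
        · rw [Set.mem_singleton_iff.mp hw]; exact hv0
  -- brick 1 and the index transfer
  have hcount := relIndex_kummer_eq_prod_of_localization_eq_zero W p m hm hPT T 𝓖 h𝓖T h𝓖off hloc0
  rw [relIndex_selmerGroup_eq_of_iff W p κ m hdiv 𝓚 𝓖 S₀ A₀ hA₀m hiffS hiffA] at hcount
  rw [hcount]
  exact Finset.prod_congr rfl fun w hw ↦ by rw [h𝓖eqT w hw]

end Count

end Summit.BirchSwinnertonDyer.Rank1Residual.Additive.RankZeroCount

end
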